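import Summits.ValiantsHypothesis.ValiantsHypothesis.Theses.TwistedDetRank
import Summits.ValiantsHypothesis.ValiantsHypothesis.Theorems.TwistedDetRankFermionicNormalFormDefs
import Summits.ValiantsHypothesis.ValiantsHypothesis.Theorems.TwistedDetRankFermionicNormalFormLocalGenerators
import Summits.ValiantsHypothesis.ValiantsHypothesis.Theorems.TwistedDetRankFermionicNormalFormSummitHard

/-!
# Birth skeleton — crux `FermionicNormalForm` (item `stmt-ValiantsHypothesis-6283`), line `birth`

Route `route-ValiantsHypothesis-TwistedDetRank`, crux
`Summit.ValiantsHypothesis.ValiantsHypothesis.Theses.TwistedDetRank.FermionicNormalForm`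
(X2, the transfer half of the thesis: every p-computable CLASS-FUNCTION generalised matrix function
`f_n = Σ_σ χ_n(σ) Π_i X_{σ(i),i}` is, for `n ≥ 1`, a sum of quasi-polynomially many Hadamard-twisted
determinants `det(X ∘ E_t)`).

This is the route's own planned layer-2 split of X2 (route header, TWO-LAYER PLAN:
`FermionicNormalForm ⇐ QuasiLocalHaveSmallTdr → CheapClassFunctionsAreQuasiLocal → FermionicNormalForm`),
typed as CLASSIFICATION + CONSTRUCTION through an explicit combinatorial normal form for class
functions, *quasi-locality* (`IsQuasiLocal`): `χ_n` is a linear combination of `≤ 2^((log₂ n + c)^c)`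
LOCAL GENERATORS of weight `≤ (log₂ n + c)^c`, a local generator of weight `w` on `S_n` being one of
the two ends of every class function KNOWN to have few twisted determinants —

* (fermionic end) `σ ↦ sgn(σ) · F(c₁(σ)) · Π_{j ∈ m} c_j(σ)` with `F : ℕ → ℂ` ARBITRARY in the number
  of fixed points `c₁`, and a monomial in the cycle counts `c_j` (`j ≥ 2`) of total weight
  `Σ_{j∈m} j ≤ w` (the determinant, `det(X∘(J+(u-1)I))`-interpolation in `c₁`, the easy immanants
  `χ^λ` with boundedly many boxes outside the first column = `sgn ·` character polynomials);
* (perturbative end) any class function supported on permutations moving `≤ w` points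
  (`σ.support.card ≤ w`; value a function of the cycle type).

SKELETON v5 (lead prover-line-stmt-ValiantsHypothesis-6283-0, 2026-08-17).  The ONLY registered stub still
open is A = `stub_cheapClassFunctionsAreQuasiLocal` (the bet; it implies the summit).  Everything else is PROVED and LANDED: stub B was reshaped into function-level
pieces — B1a `stub_smallSupportRepr`, B2a `stub_cycleCountEqCard`, B2b `stub_partialMapTwist`,
B2c `stub_cardCyclesLE` (all LANDED under `Theorems/TwistedDetRankFermionicNormalFormStub*.lean`) —
and recomposed here (§4: coefficient-form bridge `gmf_eq_of_repr`, padding, scalar absorption,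
Vandermonde interpolation in `c₁` (`exists_interp`), one twist per tuple of cycles (`tuple_twist`),
the fermionic end at a node (`fermionic_node_repr`), `localGeneratorsSmallTdr_of : B1b → B`); §5
`FermionicNormalForm_of : A → B1b → FermionicNormalForm`.  The four `Prop`s of the line live in
`Theorems/TwistedDetRankFermionicNormalFormDefs.lean` (landed) with the CALIBRATION
`valiantsHypothesis_of_cheapClassFunctionsAreQuasiLocal : A → ValiantsHypothesis` (A alone implies
the summit: `χ ≡ 1` is not quasi-local); a second calibration,
`valiantsHypothesis_of_fermionicNormalForm : FermionicNormalForm → ValiantsHypothesis` (the CRUX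
alone implies the summit: `HC ∈ VNP` and a block-swap flattening give `tdr(HC_n) ≥ 2^{n/4}`), is
proposed as `Theorems/TwistedDetRankFermionicNormalFormSummitHard.lean`.

* `stub_cheapClassFunctionsAreQuasiLocal` (CLASSIFICATION — the bet; conjecture-grade, and at
  least summit-hard by the calibration): a p-computable class-function GMF family has quasi-local
  coefficients. [Curticapean2021, Burgisser2000 Ch. 7, MertensMoore2013]

Disproof used: none exists for this crux (`ledger crux ls`: no `Disproof.lean`, no
`_false_without_` theorem, nothing under `Theorems/FermionicNormalForm/Negative/`).  The `1 ≤ n`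
guard of the crux is honoured throughout (scalars are absorbed into column/row `0`).
-/

set_option linter.dupNamespace false

namespace Summit.ValiantsHypothesis.ValiantsHypothesis.Cruxes.FermionicNormalForm.Birth

open Summit.ValiantsHypothesis.ValiantsHypothesis.Theses.TwistedDetRank
open Literature.Computability.AlgebraicComplexity

/-! ## §0 The normal form

The four `Prop`s of the line — `IsLocalGenerator`, `IsQuasiLocal`, `CheapClassFunctionsAreQuasiLocal`
(A) and `LocalGeneratorsSmallTdr` (B) — are LANDED verbatim in
`Theorems/TwistedDetRankFermionicNormalFormDefs.lean` (p147426) together with the lead's calibration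
`valiantsHypothesis_of_cheapClassFunctionsAreQuasiLocal : A → ValiantsHypothesis`; this skeleton opens
that namespace instead of re-declaring them. -/

open Summit.ValiantsHypothesis.ValiantsHypothesis.Theorems.TwistedDetRankFermionicNormalForm

/-- CALIBRATION (landed, p147426): the bet A alone implies the summit — `χ ≡ 1` is not quasi-local
(an `n`-cycle and a permutation of type `(W+2, n-W-2)` agree on every local generator of weight `W`
up to sign) and `per` is p-computable under `VP ℂ = VNP ℂ`.  So A is at least summit-hard. -/
theorem stubA_implies_summit : CheapClassFunctionsAreQuasiLocal → _root_.ValiantsHypothesis :=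
  valiantsHypothesis_of_cheapClassFunctionsAreQuasiLocal

/-! ## §1 The registered stubs still open -/

/-- Stub A (registered obligation; signature = `CheapClassFunctionsAreQuasiLocal` verbatim).
[conjecture-grade: Curticapean2021, Burgisser2000 Ch. 7, MertensMoore2013] -/
theorem stub_cheapClassFunctionsAreQuasiLocal :
    ∀ χ : (n : ℕ) → Equiv.Perm (Fin n) → ℂ,
      (∀ (n : ℕ) (σ τ : Equiv.Perm (Fin n)), χ n (τ * σ * τ⁻¹) = χ n σ) →
      IsPComputable (fun n => ∑ σ : Equiv.Perm (Fin n), MvPolynomial.C (χ n σ) *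
        ∏ i : Fin n, (MvPolynomial.X (σ i, i) : MvPolynomial (Fin n × Fin n) ℂ)) →
      IsQuasiLocal χ := by
  sorry

/-! ## §1b The construction half B — LANDED

Stub B (`LocalGeneratorsSmallTdr`) is the tree theorem `stub_localGeneratorsSmallTdr` of
`Theorems/TwistedDetRankFermionicNormalFormLocalGenerators.lean` (unconditional), assembled from the
landed function-level stubs B1a/B1b/B2a/B2b/B2c and the cone glue
(`Theorems/TwistedDetRankFermionicNormalFormConeGlue.lean`). -/

/-- B holds (tree). -/
theorem localGeneratorsSmallTdr_holds : LocalGeneratorsSmallTdr := stub_localGeneratorsSmallTdr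

/-! ## Name-keyed aliases of the two stub statements (hypotheses of the composition)

`Registered.stub_X` is the statement of `stub_X` under the registered stub's short name, so that the
native skeleton audit (`#h21_check_skeleton`: hypotheses admissible iff registered obligations /
declared stubs BY NAME) accepts `FermionicNormalForm_of : Registered.stub_… → Registered.stub_… →
FermionicNormalForm` (device of `Cruxes/RestorationQP/Lines/birth.lean`). -/
namespace Registered

/-- Alias of `CheapClassFunctionsAreQuasiLocal` (= the signature of
`stub_cheapClassFunctionsAreQuasiLocal`, stub A). -/
abbrev stub_cheapClassFunctionsAreQuasiLocal : Prop := CheapClassFunctionsAreQuasiLocal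

end Registered

/-! ## §2 Glue lemmas (sorry-free) -/

/-- The Hadamard-twisted determinant `det(X ∘ E)` (route convention, verbatim). -/
noncomputable def twDet {n : ℕ} (E : Matrix (Fin n) (Fin n) ℂ) : MvPolynomial (Fin n × Fin n) ℂ :=
  (Matrix.of fun i j => MvPolynomial.C (E i j) * MvPolynomial.X (i, j)).det

/-- The generalised matrix function with coefficient function `g` (route convention, verbatim). -/
noncomputable def gmf {n : ℕ} (g : Equiv.Perm (Fin n) → ℂ) : MvPolynomial (Fin n × Fin n) ℂ :=
  ∑ σ : Equiv.Perm (Fin n), MvPolynomial.C (g σ) *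
    ∏ i : Fin n, (MvPolynomial.X (σ i, i) : MvPolynomial (Fin n × Fin n) ℂ)

/-- Scaling row `i₀` of a twist. -/
def scaleRow {n : ℕ} (i₀ : Fin n) (a : ℂ) (E : Matrix (Fin n) (Fin n) ℂ) :
    Matrix (Fin n) (Fin n) ℂ :=
  E.updateRow i₀ (a • E i₀)

/-- A scalar multiple of a twisted determinant is a twisted determinant (scale one row of the
twist; `det` is linear in each row). [folklore; Mathlib `Matrix.det_updateRow_smul`] -/
theorem twDet_scaleRow {n : ℕ} (i₀ : Fin n) (a : ℂ) (E : Matrix (Fin n) (Fin n) ℂ) :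
    twDet (scaleRow i₀ a E) = MvPolynomial.C a * twDet E := by
  unfold twDet scaleRow
  have h : (Matrix.of fun i j =>
        MvPolynomial.C ((E.updateRow i₀ (a • E i₀)) i j) * MvPolynomial.X (i, j) :
        Matrix (Fin n) (Fin n) (MvPolynomial (Fin n × Fin n) ℂ)) =
      (Matrix.of fun i j => MvPolynomial.C (E i j) * MvPolynomial.X (i, j)).updateRow i₀
        ((MvPolynomial.C a : MvPolynomial (Fin n × Fin n) ℂ) •
          (Matrix.of fun i j => MvPolynomial.C (E i j) * MvPolynomial.X (i, j) :
            Matrix (Fin n) (Fin n) (MvPolynomial (Fin n × Fin n) ℂ)) i₀) := by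
    ext i j
    by_cases hi : i = i₀
    · subst hi
      simp [Matrix.updateRow_self, mul_assoc]
    · simp [Matrix.updateRow_ne hi]
  rw [h, Matrix.det_updateRow_smul, Matrix.updateRow_eq_self]

/-- Linearity of `g ↦ gmf g` over finite linear combinations. [folklore] -/
theorem gmf_sum_smul {n r : ℕ} (a : Fin r → ℂ) (g : Fin r → Equiv.Perm (Fin n) → ℂ) :
    gmf (∑ t, a t • g t) = ∑ t, MvPolynomial.C (a t) * gmf (g t) := by
  unfold gmf
  simp only [Finset.sum_apply, Pi.smul_apply, smul_eq_mul, map_sum, map_mul, Finset.sum_mul,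
    Finset.mul_sum, mul_assoc]
  exact Finset.sum_comm

/-- The linear-combination step of the composition: if each generator `g t` is a sum of `B`
twisted determinants, then `Σ_t a_t • g_t` is a sum of `r·B` twisted determinants (scalars
absorbed into row `i₀`, pairs re-indexed by `finProdFinEquiv`). [folklore] -/
theorem gmf_sum_smul_repr {n r B : ℕ} (i₀ : Fin n) (a : Fin r → ℂ)
    (g : Fin r → Equiv.Perm (Fin n) → ℂ) (E : Fin r → Fin B → Matrix (Fin n) (Fin n) ℂ)
    (hE : ∀ t, gmf (g t) = ∑ s, twDet (E t s)) :
    gmf (∑ t, a t • g t) =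
      ∑ u : Fin (r * B), twDet (scaleRow i₀ (a (finProdFinEquiv.symm u).1)
        (E (finProdFinEquiv.symm u).1 (finProdFinEquiv.symm u).2)) := by
  have h1 : ∀ t, MvPolynomial.C (a t) * gmf (g t) = ∑ s, twDet (scaleRow i₀ (a t) (E t s)) := by
    intro t
    rw [hE t, Finset.mul_sum]
    refine Finset.sum_congr rfl fun s _ => ?_
    rw [twDet_scaleRow]
  calc gmf (∑ t, a t • g t) = ∑ t, MvPolynomial.C (a t) * gmf (g t) := gmf_sum_smul a g
    _ = ∑ t, ∑ s, twDet (scaleRow i₀ (a t) (E t s)) := Finset.sum_congr rfl fun t _ => h1 t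
    _ = ∑ p : Fin r × Fin B, twDet (scaleRow i₀ (a p.1) (E p.1 p.2)) :=
        (Fintype.sum_prod_type' fun t s => twDet (scaleRow i₀ (a t) (E t s))).symm
    _ = ∑ u : Fin (r * B), twDet (scaleRow i₀ (a (finProdFinEquiv.symm u).1)
          (E (finProdFinEquiv.symm u).1 (finProdFinEquiv.symm u).2)) :=
        (Equiv.sum_comp finProdFinEquiv.symm
          (fun p : Fin r × Fin B => twDet (scaleRow i₀ (a p.1) (E p.1 p.2)))).symm

/-- Count bookkeeping of the composition: with `M = (log₂ n + c₁)^c₁`,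
`2^M · (n+1)^(M+1) ≤ 2^((log₂ n + c)^c)` for `c = c₁ + 3` and every `n`. [folklore] -/
theorem qp_mul_absorb (c₁ : ℕ) : ∃ c : ℕ, ∀ n : ℕ,
    2 ^ ((Nat.log 2 n + c₁) ^ c₁) * (n + 1) ^ ((Nat.log 2 n + c₁) ^ c₁ + 1) ≤
      2 ^ ((Nat.log 2 n + c) ^ c) := by
  refine ⟨c₁ + 3, fun n => ?_⟩
  have hn : n < 2 ^ (Nat.log 2 n + 1) := Nat.lt_pow_succ_log_self Nat.one_lt_two n
  generalize Nat.log 2 n = L at hn ⊢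
  set M : ℕ := (L + c₁) ^ c₁ with hM
  set B : ℕ := L + (c₁ + 3) with hB
  have hB1 : 1 ≤ B := by omega
  have hB2 : 2 ≤ B := by omega
  have hMB : M ≤ B ^ c₁ := by
    rw [hM]; exact Nat.pow_le_pow_left (by omega) _
  have hpow1 : 1 ≤ B ^ c₁ := Nat.one_le_pow _ _ (by omega)
  -- the exponent: `M + (L+1)(M+1) ≤ B^(c₁+3)`
  have hexp : M + (L + 1) * (M + 1) ≤ B ^ (c₁ + 3) :=
    calc M + (L + 1) * (M + 1) ≤ (L + 2) * (M + 1) := by nlinarith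
      _ ≤ B * (B ^ c₁ + 1) := Nat.mul_le_mul (by omega) (by omega)
      _ ≤ B * (2 * B ^ c₁) := Nat.mul_le_mul_left _ (by omega)
      _ ≤ B * (B * B ^ c₁) := Nat.mul_le_mul_left _ (Nat.mul_le_mul_right _ hB2)
      _ = B ^ (c₁ + 2) := by ring
      _ ≤ B ^ (c₁ + 3) := Nat.pow_le_pow_right hB1 (by omega)
  -- the base: `(n+1)^(M+1) ≤ 2^((L+1)(M+1))`
  have hbase : (n + 1) ^ (M + 1) ≤ 2 ^ ((L + 1) * (M + 1)) :=
    calc (n + 1) ^ (M + 1) ≤ (2 ^ (L + 1)) ^ (M + 1) := Nat.pow_le_pow_left (by omega) _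
      _ = 2 ^ ((L + 1) * (M + 1)) := (pow_mul 2 _ _).symm
  calc 2 ^ M * (n + 1) ^ (M + 1) ≤ 2 ^ M * 2 ^ ((L + 1) * (M + 1)) := Nat.mul_le_mul_left _ hbase
    _ = 2 ^ (M + (L + 1) * (M + 1)) := (pow_add 2 _ _).symm
    _ ≤ 2 ^ (B ^ (c₁ + 3)) := Nat.pow_le_pow_right (by norm_num) hexp

/-! ## §3 The composition (kernel-checked): A gives the crux -/

/-- **Composition** (the glue of the line, kernel-checked, no `sorry`): CLASSIFICATION (A) and
CONSTRUCTION (B, the tree theorem `stub_localGeneratorsSmallTdr`) give the fermionic normal form. For a p-computable class-function family take the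
quasi-local expansion `χ_n = Σ_{t<r} a_t • g_t` (`r ≤ 2^M` generators of weight `≤ M`,
`M = (log₂ n + c₁)^c₁`) from A and the `(n+1)^(M+1)` twists of each generator from B, absorb `a_t`
into row `0` of each twist (`twDet_scaleRow`; this is where `1 ≤ n` is used), re-index
`Fin r × Fin B ≃ Fin (r·B)` (`gmf_sum_smul_repr`) and bound
`r·B ≤ 2^M (n+1)^(M+1) ≤ 2^((log₂ n + c)^c)` (`qp_mul_absorb`). [folklore] -/
theorem FermionicNormalForm_of :
    Registered.stub_cheapClassFunctionsAreQuasiLocal → FermionicNormalForm := by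
  intro hA χ hcl hP
  have hB : LocalGeneratorsSmallTdr := localGeneratorsSmallTdr_holds
  obtain ⟨c₁, hq⟩ := hA χ hcl hP
  obtain ⟨c, hc⟩ := qp_mul_absorb c₁
  refine ⟨c, fun n hn => ?_⟩
  obtain ⟨r, hr, a, g, hg, hχ⟩ := hq n hn
  -- `(n+1)^(M+1)` twists for each generator (stub B), chosen uniformly in `t`
  choose E hE using fun t : Fin r => hB n ((Nat.log 2 n + c₁) ^ c₁) (g t) hn (hg t)
  have hE' : ∀ t : Fin r, gmf (g t) = ∑ s, twDet (E t s) := fun t => hE t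
  -- the linear combination, scalars absorbed into row `0` (`1 ≤ n`)
  have key := gmf_sum_smul_repr (⟨0, hn⟩ : Fin n) a g E hE'
  rw [← hχ] at key
  exact ⟨r * (n + 1) ^ ((Nat.log 2 n + c₁) ^ c₁ + 1),
    le_trans (Nat.mul_le_mul_right _ hr) (hc n),
    fun u => scaleRow (⟨0, hn⟩ : Fin n) (a (finProdFinEquiv.symm u).1)
      (E (finProdFinEquiv.symm u).1 (finProdFinEquiv.symm u).2),
    key⟩

/-- Wiring check: the registered stubs feed `FermionicNormalForm_of` exactly as stated, so the
skeleton is `FermionicNormalForm` closed modulo stub A alone (the only sorry). -/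
example : FermionicNormalForm := FermionicNormalForm_of stub_cheapClassFunctionsAreQuasiLocal

/-- And the crux, once proved, gives the summit by itself (tree, p148124). -/
example : Registered.stub_cheapClassFunctionsAreQuasiLocal → _root_.ValiantsHypothesis :=
  fun hA => valiantsHypothesis_of_fermionicNormalForm (FermionicNormalForm_of hA)

end Summit.ValiantsHypothesis.ValiantsHypothesis.Cruxes.FermionicNormalForm.Birth
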